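import Summits.AtomisticToContinuum.Crystallization.Theses.GappedShellCensus
import Literature.Geometry.DiscreteGeometry.ShellCensusFrame
import Literature.Geometry.DiscreteGeometry.LayerShells

/-!
# No bonded 4-cycle among the bonded neighbours of a shell point

Worker lemma `stub_noFourCycle` of the crux `GappedShellCensus.ShellTrichotomy`
(line `Sketch`, census half; "`4T` is dead").

If `v a b c d ∈ ℝ³` all have norm in `[0.98, 1.02]`, the shell point `v` is bonded (distance in
`[0.98, 1.02]`) to each of `a b c d`, the four neighbours form a bonded `4`-cycle `a–b–c–d–a`,
and both diagonals `a c`, `b d` respect the hard core `≥ 0.98`, we derive `False`.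

Proof (folklore, elementary). A linear isometry (`ShellCensus.exists_frame`) puts `v` at
`(0, 0, r)`, `r = ‖v‖`. Every neighbour `w` then splits into a height `w₂ ∈ [0.44, 0.56]` and a
planar part `W = (w₀, w₁)` with `|W|² ∈ [0.6468, 0.8468]` (`noFourCycle_height`); a bond `u w`
pins the planar dot product `U · W ∈ [0.1266, 0.3666]` (`noFourCycle_dt`), hence, by the
Lagrange identity, the planar cross product `U × W` has modulus in `[0.53, 0.84]`
(`noFourCycle_cr_sq`): seen from the axis `0v`, every bond of the cycle turns by an angle
strictly between `0°` and `90°`, to the left or to the right.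
* If two consecutive bonds turn to opposite sides (a fold-back at the shared vertex `W`, arms
  `U`, `X`), then `|W|² |U - X|² = (U · W - W · X)² + (U × W + W × X)² ≤ 0.24² + 0.31²`, so the
  two arms are at squared distance `< 0.26 < 0.98²` (`noFourCycle_fold`): the hard core on that
  diagonal is violated.
* Otherwise all four bonds turn the same way, say counter-clockwise (the clockwise case is the
  reversed cycle `a d c b`). The angle-addition identities
  `|B|² (A × C) = (A · B)(B × C) + (A × B)(B · C) > 0` and
  `|D|² (A × C) = -(D · A)(C × D) - (D × A)(C · D) < 0` then contradict each other
  (`noFourCycle_chain`): four turns of less than `90°` each cannot close up.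
All estimates are closed by `linarith` on explicit products of the window bounds.
-/

noncomputable section

namespace Summit.AtomisticToContinuum.Crystallization.Theorems

open scoped RealInnerProductSpace

/-- The square of a real number in `[49/50, 51/50]` lies in `[2401/2500, 2601/2500]`. -/
private lemma noFourCycle_sq_window {t : ℝ} (h : 1 - 1 / 50 ≤ t ∧ t ≤ 1 + 1 / 50) :
    2401 / 2500 ≤ t ^ 2 ∧ t ^ 2 ≤ 2601 / 2500 := by
  obtain ⟨h1, h2⟩ := h
  constructor <;> nlinarith

/-- The square of a real number `≥ 49/50` is `≥ 2401/2500`. -/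
private lemma noFourCycle_sq_lower {t : ℝ} (h : 1 - 1 / 50 ≤ t) : 2401 / 2500 ≤ t ^ 2 := by
  nlinarith

/-- **Height and planar radius of a bonded neighbour.** In the frame `v = (0, 0, r)`,
`r ∈ [0.98, 1.02]`, a point `w` with `‖w‖², ‖w - v‖² ∈ [0.9604, 1.0404]` has height
`w₂ ∈ [0.44, 0.56]` and squared planar radius `w₀² + w₁² ∈ [0.6468, 0.8468]`. -/
private lemma noFourCycle_height {r w₀ w₁ w₂ : ℝ} (hr : 1 - 1 / 50 ≤ r ∧ r ≤ 1 + 1 / 50)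
    (hn : 2401 / 2500 ≤ w₀ ^ 2 + w₁ ^ 2 + w₂ ^ 2 ∧ w₀ ^ 2 + w₁ ^ 2 + w₂ ^ 2 ≤ 2601 / 2500)
    (he : 2401 / 2500 ≤ w₀ ^ 2 + w₁ ^ 2 + (w₂ - r) ^ 2 ∧
      w₀ ^ 2 + w₁ ^ 2 + (w₂ - r) ^ 2 ≤ 2601 / 2500) :
    (11 / 25 ≤ w₂ ∧ w₂ ≤ 14 / 25) ∧
      (1617 / 2500 ≤ w₀ ^ 2 + w₁ ^ 2 ∧ w₀ ^ 2 + w₁ ^ 2 ≤ 2117 / 2500) := by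
  obtain ⟨hr1, hr2⟩ := hr
  obtain ⟨hn1, hn2⟩ := hn
  obtain ⟨he1, he2⟩ := he
  have h1 : 11 / 25 ≤ w₂ := by
    by_contra h
    have h' := lt_of_not_ge h
    linarith only [hn1, he2, hr1, h', mul_nonneg (sub_nonneg.2 hr1) (sub_nonneg.2 h'.le),
      mul_nonneg (sub_nonneg.2 hr1) (sub_nonneg.2 hr1)]
  have h2 : w₂ ≤ 14 / 25 := by
    by_contra h
    have h' := lt_of_not_ge h
    linarith only [hn2, he1, hr1, hr2, h', mul_nonneg (sub_nonneg.2 hr1) (sub_nonneg.2 h'.le),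
      mul_nonneg (sub_nonneg.2 hr1) (sub_nonneg.2 hr2)]
  refine ⟨⟨h1, h2⟩, ?_, ?_⟩
  · linarith only [hn1, h2, mul_nonneg (sub_nonneg.2 h2) (sub_nonneg.2 h1)]
  · linarith only [hn2, h1, mul_nonneg (sub_nonneg.2 h1) (sub_nonneg.2 h1)]

/-- **Planar dot product of a bonded pair.** For two neighbours `u, w` of heights in
`[0.44, 0.56]` with `‖u‖², ‖w‖², ‖u - w‖² ∈ [0.9604, 1.0404]`, the dot product of the planar
parts `u₀ w₀ + u₁ w₁ = ⟪u, w⟫ - u₂ w₂` lies in `[0.1266, 0.3666]`. -/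
private lemma noFourCycle_dt {u₀ u₁ u₂ w₀ w₁ w₂ : ℝ}
    (hu : 2401 / 2500 ≤ u₀ ^ 2 + u₁ ^ 2 + u₂ ^ 2 ∧ u₀ ^ 2 + u₁ ^ 2 + u₂ ^ 2 ≤ 2601 / 2500)
    (hw : 2401 / 2500 ≤ w₀ ^ 2 + w₁ ^ 2 + w₂ ^ 2 ∧ w₀ ^ 2 + w₁ ^ 2 + w₂ ^ 2 ≤ 2601 / 2500)
    (huw : 2401 / 2500 ≤ (u₀ - w₀) ^ 2 + (u₁ - w₁) ^ 2 + (u₂ - w₂) ^ 2 ∧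
      (u₀ - w₀) ^ 2 + (u₁ - w₁) ^ 2 + (u₂ - w₂) ^ 2 ≤ 2601 / 2500)
    (hu₂ : 11 / 25 ≤ u₂ ∧ u₂ ≤ 14 / 25) (hw₂ : 11 / 25 ≤ w₂ ∧ w₂ ≤ 14 / 25) :
    633 / 5000 ≤ u₀ * w₀ + u₁ * w₁ ∧ u₀ * w₀ + u₁ * w₁ ≤ 1833 / 5000 := by
  obtain ⟨hu1, hu2⟩ := hu
  obtain ⟨hw1, hw2⟩ := hw
  obtain ⟨huw1, huw2⟩ := huw
  constructor
  · linarith only [hu1, hw1, huw2, hu₂.2, hw₂.2,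
      mul_nonneg (sub_nonneg.2 hu₂.2) (sub_nonneg.2 hw₂.1)]
  · linarith only [hu2, hw2, huw1, hu₂.1, hw₂.1,
      mul_nonneg (sub_nonneg.2 hu₂.1) (sub_nonneg.2 hw₂.1)]

/-- **Planar cross product of a bonded pair.** With planar radii² in `[0.6468, 0.8468]` and
planar dot product in `[0.1266, 0.3666]`, the Lagrange identity
`cross² = |U|² |W|² - dot²` puts `cross²` in `[0.2809, 0.7056] = [0.53², 0.84²]`. -/
private lemma noFourCycle_cr_sq {u₀ u₁ w₀ w₁ : ℝ}
    (hρu : 1617 / 2500 ≤ u₀ ^ 2 + u₁ ^ 2 ∧ u₀ ^ 2 + u₁ ^ 2 ≤ 2117 / 2500)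
    (hρw : 1617 / 2500 ≤ w₀ ^ 2 + w₁ ^ 2 ∧ w₀ ^ 2 + w₁ ^ 2 ≤ 2117 / 2500)
    (hdt : 633 / 5000 ≤ u₀ * w₀ + u₁ * w₁ ∧ u₀ * w₀ + u₁ * w₁ ≤ 1833 / 5000) :
    2809 / 10000 ≤ (u₀ * w₁ - u₁ * w₀) ^ 2 ∧ (u₀ * w₁ - u₁ * w₀) ^ 2 ≤ 7056 / 10000 := by
  have key : (u₀ * w₁ - u₁ * w₀) ^ 2 =
      (u₀ ^ 2 + u₁ ^ 2) * (w₀ ^ 2 + w₁ ^ 2) - (u₀ * w₀ + u₁ * w₁) ^ 2 := by ring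
  rw [key]
  constructor
  · linarith only [hρu.1, hρw.1, hdt.2, mul_nonneg (sub_nonneg.2 hρu.1) (sub_nonneg.2 hρw.1),
      mul_nonneg (sub_nonneg.2 hdt.2) (sub_nonneg.2 hdt.1)]
  · linarith only [hρu.2, hρw.2, hdt.1, mul_nonneg (sub_nonneg.2 hρu.2) (sub_nonneg.2 hρw.1),
      mul_nonneg (sub_nonneg.2 hdt.1) (sub_nonneg.2 hdt.1)]

/-- From `x² ≥ 0.53²`: `x ≥ 0.53` or `x ≤ -0.53`. -/
private lemma noFourCycle_sign {x : ℝ} (h : 2809 / 10000 ≤ x ^ 2) :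
    53 / 100 ≤ x ∨ x ≤ -(53 / 100) := by
  rcases le_or_gt (53 / 100) x with h1 | h1
  · exact Or.inl h1
  · right
    by_contra h2
    have A : 0 < 53 / 100 - x := by linarith
    have B : 0 < 53 / 100 + x := by linarith [lt_of_not_ge h2]
    linarith [mul_pos A B]

/-- From `x² ≤ 0.84²`: `|x| ≤ 0.84`. -/
private lemma noFourCycle_abs_le {x : ℝ} (h : x ^ 2 ≤ 7056 / 10000) :
    -(84 / 100) ≤ x ∧ x ≤ 84 / 100 := by
  constructor
  · by_contra h'
    have A : 0 < -(84 / 100) - x := by linarith only [lt_of_not_ge h']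
    have B : 0 < 84 / 100 - x := by linarith only [lt_of_not_ge h']
    linarith only [mul_pos A B, h]
  · by_contra h'
    have A : 0 < x - 84 / 100 := by linarith only [lt_of_not_ge h']
    have B : 0 < x + 84 / 100 := by linarith only [lt_of_not_ge h']
    linarith only [mul_pos A B, h]

/-- **Fold-back.** Two arms `U, X` bonded to the same middle neighbour `W` and folded to the
same side of it (incoming and outgoing crosses of opposite signs) are close: writing
`|W|² |U - X|² = (dot_U - dot_X)² + (cross_U + cross_X)²` with both dots in `[0.1266, 0.3666]`,
`cross_U ∈ ±[0.53, 0.84]`, `cross_X ∈ ∓[0.53, 0.84]`, and heights within `0.12`, the squared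
distance of the two arms is `< 0.26 < 0.9604`. -/
private lemma noFourCycle_fold {ρ P dU dX cU cX hU hX : ℝ}
    (hρ : 1617 / 2500 ≤ ρ) (hP : 0 ≤ P) (hkey : ρ * P = (dU - dX) ^ 2 + (cU + cX) ^ 2)
    (hdU : 633 / 5000 ≤ dU ∧ dU ≤ 1833 / 5000) (hdX : 633 / 5000 ≤ dX ∧ dX ≤ 1833 / 5000)
    (hcU : 2809 / 10000 ≤ cU ^ 2 ∧ cU ^ 2 ≤ 7056 / 10000)
    (hcX : 2809 / 10000 ≤ cX ^ 2 ∧ cX ^ 2 ≤ 7056 / 10000) (hs : cU * cX ≤ 0)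
    (hhU : 11 / 25 ≤ hU ∧ hU ≤ 14 / 25) (hhX : 11 / 25 ≤ hX ∧ hX ≤ 14 / 25) :
    P + (hU - hX) ^ 2 < 2401 / 2500 := by
  have hd : (dU - dX) ^ 2 ≤ (6 / 25) ^ 2 := by
    have A : 0 ≤ 6 / 25 - (dU - dX) := by linarith only [hdU.2, hdX.1]
    have B : 0 ≤ 6 / 25 + (dU - dX) := by linarith only [hdU.1, hdX.2]
    linarith only [mul_nonneg A B]
  -- the two crosses have opposite signs and modulus in `[0.53, 0.84]`
  have hc : (cU + cX) ^ 2 ≤ (31 / 100) ^ 2 := by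
    obtain ⟨hU3, hU4⟩ := noFourCycle_abs_le hcU.2
    obtain ⟨hX3, hX4⟩ := noFourCycle_abs_le hcX.2
    suffices h : -(31 / 100) ≤ cU + cX ∧ cU + cX ≤ 31 / 100 by
      have A : 0 ≤ 31 / 100 - (cU + cX) := by linarith only [h.2]
      have B : 0 ≤ 31 / 100 + (cU + cX) := by linarith only [h.1]
      linarith only [mul_nonneg A B]
    rcases noFourCycle_sign hcU.1 with hU1 | hU1
    · have hX0 : cX ≤ 0 := by
        by_contra h'
        linarith only [hs, mul_pos (by linarith only [hU1] : (0 : ℝ) < cU) (lt_of_not_ge h')]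
      rcases noFourCycle_sign hcX.1 with hX1 | hX1
      · exfalso
        linarith only [hX0, hX1]
      · constructor <;> linarith only [hU1, hU4, hX1, hX3]
    · have hX0 : 0 ≤ cX := by
        by_contra h'
        linarith only [hs, mul_pos_of_neg_of_neg (by linarith only [hU1] : cU < 0)
          (lt_of_not_ge h')]
      rcases noFourCycle_sign hcX.1 with hX1 | hX1
      · constructor <;> linarith only [hU1, hU3, hX1, hX4]
      · exfalso
        linarith only [hX0, hX1]
  have hh : (hU - hX) ^ 2 ≤ (3 / 25) ^ 2 := by
    have A : 0 ≤ 3 / 25 - (hU - hX) := by linarith only [hhU.2, hhX.1]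
    have B : 0 ≤ 3 / 25 + (hU - hX) := by linarith only [hhU.1, hhX.2]
    linarith only [mul_nonneg A B]
  linarith only [mul_nonneg (sub_nonneg.2 hρ) hP, hkey, hd, hc, hh]

/-- **Winding.** Four consecutive counter-clockwise planar steps `A → B → C → D → A`, each
turning by an angle with positive cosine (positive planar dot product), cannot close up: by the
angle-addition identities `|B|² cross(A,C) = dot(A,B) cross(B,C) + cross(A,B) dot(B,C) > 0` and
`|D|² cross(A,C) = -dot(D,A) cross(C,D) - cross(D,A) dot(C,D) < 0`. -/
private lemma noFourCycle_chain {ρB ρD x dAB dBC dCD dDA cAB cBC cCD cDA : ℝ}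
    (hρB : 0 ≤ ρB) (hρD : 0 ≤ ρD)
    (h1 : ρB * x = dAB * cBC + cAB * dBC) (h2 : ρD * x = -(dDA * cCD) - cDA * dCD)
    (hdAB : 0 < dAB) (hdBC : 0 < dBC) (hdCD : 0 < dCD) (hdDA : 0 < dDA)
    (hcAB : 0 < cAB) (hcBC : 0 < cBC) (hcCD : 0 < cCD) (hcDA : 0 < cDA) : False := by
  have hx : 0 < x := by
    by_contra hx
    have : ρB * x ≤ 0 := mul_nonpos_of_nonneg_of_nonpos hρB (le_of_not_gt hx)
    linarith only [h1, this, mul_pos hdAB hcBC, mul_pos hcAB hdBC]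
  have : 0 ≤ ρD * x := mul_nonneg hρD hx.le
  linarith only [h2, this, mul_pos hdDA hcCD, mul_pos hcDA hdCD]

/-- `noFourCycle_fold` in coordinates: middle neighbour `w`, incoming arm `u`, outgoing arm
`x`, crosses `cross(U, W)` and `cross(W, X)` of opposite signs (or zero). -/
private lemma noFourCycle_fold_at {w₀ w₁ u₀ u₁ u₂ x₀ x₁ x₂ : ℝ}
    (hρ : 1617 / 2500 ≤ w₀ ^ 2 + w₁ ^ 2)
    (hdU : 633 / 5000 ≤ u₀ * w₀ + u₁ * w₁ ∧ u₀ * w₀ + u₁ * w₁ ≤ 1833 / 5000)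
    (hdX : 633 / 5000 ≤ w₀ * x₀ + w₁ * x₁ ∧ w₀ * x₀ + w₁ * x₁ ≤ 1833 / 5000)
    (hcU : 2809 / 10000 ≤ (u₀ * w₁ - u₁ * w₀) ^ 2 ∧ (u₀ * w₁ - u₁ * w₀) ^ 2 ≤ 7056 / 10000)
    (hcX : 2809 / 10000 ≤ (w₀ * x₁ - w₁ * x₀) ^ 2 ∧ (w₀ * x₁ - w₁ * x₀) ^ 2 ≤ 7056 / 10000)
    (hs : (u₀ * w₁ - u₁ * w₀) * (w₀ * x₁ - w₁ * x₀) ≤ 0)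
    (hhU : 11 / 25 ≤ u₂ ∧ u₂ ≤ 14 / 25) (hhX : 11 / 25 ≤ x₂ ∧ x₂ ≤ 14 / 25) :
    (u₀ - x₀) ^ 2 + (u₁ - x₁) ^ 2 + (u₂ - x₂) ^ 2 < 2401 / 2500 :=
  noFourCycle_fold (P := (u₀ - x₀) ^ 2 + (u₁ - x₁) ^ 2) hρ (by positivity) (by ring) hdU hdX
    hcU hcX hs hhU hhX

/-- `noFourCycle_chain` in coordinates: a counter-clockwise bonded cycle `A → B → C → D → A`
of planar vectors with all four planar dot products positive does not exist. -/
private lemma noFourCycle_chain_at {a₀ a₁ b₀ b₁ c₀ c₁ d₀ d₁ : ℝ}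
    (hdAB : 0 < a₀ * b₀ + a₁ * b₁) (hdBC : 0 < b₀ * c₀ + b₁ * c₁)
    (hdCD : 0 < c₀ * d₀ + c₁ * d₁) (hdDA : 0 < d₀ * a₀ + d₁ * a₁)
    (hcAB : 0 < a₀ * b₁ - a₁ * b₀) (hcBC : 0 < b₀ * c₁ - b₁ * c₀)
    (hcCD : 0 < c₀ * d₁ - c₁ * d₀) (hcDA : 0 < d₀ * a₁ - d₁ * a₀) : False :=
  noFourCycle_chain (x := a₀ * c₁ - a₁ * c₀) (ρB := b₀ ^ 2 + b₁ ^ 2) (ρD := d₀ ^ 2 + d₁ ^ 2)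
    (by positivity) (by positivity) (by ring) (by ring) hdAB hdBC hdCD hdDA hcAB hcBC hcCD hcDA

/-- **The coordinate form.** In the frame `v = (0, 0, r)`: no four points `a b c d` of `ℝ³`
with all of `r, ‖a‖, …, ‖d‖, ‖a - v‖, …, ‖d - v‖, ‖a - b‖, ‖b - c‖, ‖c - d‖, ‖d - a‖` in
`[0.98, 1.02]` (squared: `[0.9604, 1.0404]`) have both `‖a - c‖ ≥ 0.98` and `‖b - d‖ ≥ 0.98`. -/
private lemma noFourCycle_coord {r a₀ a₁ a₂ b₀ b₁ b₂ c₀ c₁ c₂ d₀ d₁ d₂ : ℝ}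
    (hr : 1 - 1 / 50 ≤ r ∧ r ≤ 1 + 1 / 50)
    (ha : 2401 / 2500 ≤ a₀ ^ 2 + a₁ ^ 2 + a₂ ^ 2 ∧ a₀ ^ 2 + a₁ ^ 2 + a₂ ^ 2 ≤ 2601 / 2500)
    (hb : 2401 / 2500 ≤ b₀ ^ 2 + b₁ ^ 2 + b₂ ^ 2 ∧ b₀ ^ 2 + b₁ ^ 2 + b₂ ^ 2 ≤ 2601 / 2500)
    (hc : 2401 / 2500 ≤ c₀ ^ 2 + c₁ ^ 2 + c₂ ^ 2 ∧ c₀ ^ 2 + c₁ ^ 2 + c₂ ^ 2 ≤ 2601 / 2500)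
    (hd : 2401 / 2500 ≤ d₀ ^ 2 + d₁ ^ 2 + d₂ ^ 2 ∧ d₀ ^ 2 + d₁ ^ 2 + d₂ ^ 2 ≤ 2601 / 2500)
    (hva : 2401 / 2500 ≤ a₀ ^ 2 + a₁ ^ 2 + (a₂ - r) ^ 2 ∧
      a₀ ^ 2 + a₁ ^ 2 + (a₂ - r) ^ 2 ≤ 2601 / 2500)
    (hvb : 2401 / 2500 ≤ b₀ ^ 2 + b₁ ^ 2 + (b₂ - r) ^ 2 ∧
      b₀ ^ 2 + b₁ ^ 2 + (b₂ - r) ^ 2 ≤ 2601 / 2500)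
    (hvc : 2401 / 2500 ≤ c₀ ^ 2 + c₁ ^ 2 + (c₂ - r) ^ 2 ∧
      c₀ ^ 2 + c₁ ^ 2 + (c₂ - r) ^ 2 ≤ 2601 / 2500)
    (hvd : 2401 / 2500 ≤ d₀ ^ 2 + d₁ ^ 2 + (d₂ - r) ^ 2 ∧
      d₀ ^ 2 + d₁ ^ 2 + (d₂ - r) ^ 2 ≤ 2601 / 2500)
    (hab : 2401 / 2500 ≤ (a₀ - b₀) ^ 2 + (a₁ - b₁) ^ 2 + (a₂ - b₂) ^ 2 ∧
      (a₀ - b₀) ^ 2 + (a₁ - b₁) ^ 2 + (a₂ - b₂) ^ 2 ≤ 2601 / 2500)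
    (hbc : 2401 / 2500 ≤ (b₀ - c₀) ^ 2 + (b₁ - c₁) ^ 2 + (b₂ - c₂) ^ 2 ∧
      (b₀ - c₀) ^ 2 + (b₁ - c₁) ^ 2 + (b₂ - c₂) ^ 2 ≤ 2601 / 2500)
    (hcd : 2401 / 2500 ≤ (c₀ - d₀) ^ 2 + (c₁ - d₁) ^ 2 + (c₂ - d₂) ^ 2 ∧
      (c₀ - d₀) ^ 2 + (c₁ - d₁) ^ 2 + (c₂ - d₂) ^ 2 ≤ 2601 / 2500)
    (hda : 2401 / 2500 ≤ (d₀ - a₀) ^ 2 + (d₁ - a₁) ^ 2 + (d₂ - a₂) ^ 2 ∧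
      (d₀ - a₀) ^ 2 + (d₁ - a₁) ^ 2 + (d₂ - a₂) ^ 2 ≤ 2601 / 2500)
    (hac : 2401 / 2500 ≤ (a₀ - c₀) ^ 2 + (a₁ - c₁) ^ 2 + (a₂ - c₂) ^ 2)
    (hbd : 2401 / 2500 ≤ (b₀ - d₀) ^ 2 + (b₁ - d₁) ^ 2 + (b₂ - d₂) ^ 2) : False := by
  -- heights and planar radii of the four neighbours
  obtain ⟨hA2, hAρ⟩ := noFourCycle_height hr ha hva
  obtain ⟨hB2, hBρ⟩ := noFourCycle_height hr hb hvb
  obtain ⟨hC2, hCρ⟩ := noFourCycle_height hr hc hvc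
  obtain ⟨hD2, hDρ⟩ := noFourCycle_height hr hd hvd
  -- planar dot products of the four bonds
  have dAB := noFourCycle_dt ha hb hab hA2 hB2
  have dBC := noFourCycle_dt hb hc hbc hB2 hC2
  have dCD := noFourCycle_dt hc hd hcd hC2 hD2
  have dDA := noFourCycle_dt hd ha hda hD2 hA2
  -- squared planar cross products of the four bonds
  have cAB := noFourCycle_cr_sq hAρ hBρ dAB
  have cBC := noFourCycle_cr_sq hBρ hCρ dBC
  have cCD := noFourCycle_cr_sq hCρ hDρ dCD
  have cDA := noFourCycle_cr_sq hDρ hAρ dDA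
  -- no fold-back at `b`, `c`, `d`: consecutive crosses have the same sign
  have nB : 0 < (a₀ * b₁ - a₁ * b₀) * (b₀ * c₁ - b₁ * c₀) := by
    by_contra h
    have := noFourCycle_fold_at hBρ.1 dAB dBC cAB cBC (le_of_not_gt h) hA2 hC2
    linarith only [this, hac]
  have nC : 0 < (b₀ * c₁ - b₁ * c₀) * (c₀ * d₁ - c₁ * d₀) := by
    by_contra h
    have := noFourCycle_fold_at hCρ.1 dBC dCD cBC cCD (le_of_not_gt h) hB2 hD2
    linarith only [this, hbd]
  have nD : 0 < (c₀ * d₁ - c₁ * d₀) * (d₀ * a₁ - d₁ * a₀) := by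
    by_contra h
    have := noFourCycle_fold_at hDρ.1 dCD dDA cCD cDA (le_of_not_gt h) hC2 hA2
    linarith only [this, hac]
  rcases noFourCycle_sign cAB.1 with hAB | hAB
  · -- counter-clockwise all the way round
    have hAB' : 0 < a₀ * b₁ - a₁ * b₀ := lt_of_lt_of_le (by norm_num) hAB
    have hBC' : 0 < b₀ * c₁ - b₁ * c₀ := pos_of_mul_pos_right nB hAB'.le
    have hCD' : 0 < c₀ * d₁ - c₁ * d₀ := pos_of_mul_pos_right nC hBC'.le
    have hDA' : 0 < d₀ * a₁ - d₁ * a₀ := pos_of_mul_pos_right nD hCD'.le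
    exact noFourCycle_chain_at (lt_of_lt_of_le (by norm_num) dAB.1)
      (lt_of_lt_of_le (by norm_num) dBC.1) (lt_of_lt_of_le (by norm_num) dCD.1)
      (lt_of_lt_of_le (by norm_num) dDA.1) hAB' hBC' hCD' hDA'
  · -- clockwise all the way round: the reversed cycle `a d c b` is counter-clockwise
    have hAB' : a₀ * b₁ - a₁ * b₀ < 0 := lt_of_le_of_lt hAB (by norm_num)
    have hBC' : b₀ * c₁ - b₁ * c₀ < 0 := neg_of_mul_pos_right nB hAB'.le
    have hCD' : c₀ * d₁ - c₁ * d₀ < 0 := neg_of_mul_pos_right nC hBC'.le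
    have hDA' : d₀ * a₁ - d₁ * a₀ < 0 := neg_of_mul_pos_right nD hCD'.le
    exact noFourCycle_chain_at (a₀ := a₀) (a₁ := a₁) (b₀ := d₀) (b₁ := d₁) (c₀ := c₀)
      (c₁ := c₁) (d₀ := b₀) (d₁ := b₁) (by linarith only [dDA.1]) (by linarith only [dCD.1])
      (by linarith only [dBC.1]) (by linarith only [dAB.1]) (by linarith only [hDA'])
      (by linarith only [hCD']) (by linarith only [hBC']) (by linarith only [hAB'])

open Literature.Geometry.DiscreteGeometry in
/-- **No bonded 4-cycle among the bonded neighbours of a shell point** ("`4T` is dead").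
If `v a b c d ∈ ℝ³` all have norm in `[0.98, 1.02]`, `v` is bonded (distance in `[0.98, 1.02]`)
to each of `a b c d`, and `a b c d` form a bonded `4`-cycle `a–b–c–d–a`, then one of the two
diagonals `a c`, `b d` is shorter than `0.98`.

Proof. Put `v` on the positive `z`-axis by a linear isometry (`ShellCensus.exists_frame`) and
split each neighbour `w` into its height `w₂ ∈ [0.44, 0.56]` and its planar part `W` with
`|W|² ∈ [0.6468, 0.8468]`; a bond `u w` forces the planar dot product into `[0.1266, 0.3666]`,
so (Lagrange) the planar cross product has modulus in `[0.53, 0.84]`: seen from the axis, each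
bond turns by an angle strictly between `0°` and `90°`, to the left or to the right. If two
consecutive bonds of the cycle turn to opposite sides (a fold-back at the shared vertex), the two
outer vertices nearly coincide (`noFourCycle_fold`: squared distance `< 0.26`), contradicting the
hard core on that diagonal. Otherwise all four bonds turn the same way, and four turns of less
than `90°` each cannot close up the cycle (`noFourCycle_chain`, via the angle-addition
identities for dot and cross products). -/
theorem stub_noFourCycle (v a b c d : EuclideanSpace ℝ (Fin 3))
    (hv : 1 - 1 / 50 ≤ ‖v‖ ∧ ‖v‖ ≤ 1 + 1 / 50) (ha : 1 - 1 / 50 ≤ ‖a‖ ∧ ‖a‖ ≤ 1 + 1 / 50)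
    (hb : 1 - 1 / 50 ≤ ‖b‖ ∧ ‖b‖ ≤ 1 + 1 / 50) (hc : 1 - 1 / 50 ≤ ‖c‖ ∧ ‖c‖ ≤ 1 + 1 / 50)
    (hd : 1 - 1 / 50 ≤ ‖d‖ ∧ ‖d‖ ≤ 1 + 1 / 50)
    (hva : 1 - 1 / 50 ≤ dist v a ∧ dist v a ≤ 1 + 1 / 50) (hvb : 1 - 1 / 50 ≤ dist v b ∧ dist v b ≤ 1 + 1 / 50)
    (hvc : 1 - 1 / 50 ≤ dist v c ∧ dist v c ≤ 1 + 1 / 50) (hvd : 1 - 1 / 50 ≤ dist v d ∧ dist v d ≤ 1 + 1 / 50)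
    (hab : 1 - 1 / 50 ≤ dist a b ∧ dist a b ≤ 1 + 1 / 50) (hbc : 1 - 1 / 50 ≤ dist b c ∧ dist b c ≤ 1 + 1 / 50)
    (hcd : 1 - 1 / 50 ≤ dist c d ∧ dist c d ≤ 1 + 1 / 50) (hda : 1 - 1 / 50 ≤ dist d a ∧ dist d a ≤ 1 + 1 / 50)
    (hac : 1 - 1 / 50 ≤ dist a c) (hbd : 1 - 1 / 50 ≤ dist b d) : False := by
  -- frame: `v ↦ (0, 0, ‖v‖)`
  obtain ⟨A, h0, h1, h2, -, -, -⟩ := ShellCensus.exists_frame ![v, a, b, c, d] 0 1 2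
  simp only [Matrix.cons_val_zero] at h0 h1 h2
  -- transport every hypothesis along the isometry `A`
  rw [← A.norm_map] at ha hb hc hd
  rw [← A.dist_map] at hva hvb hvc hvd hab hbc hcd hda hac hbd
  -- squared, in coordinates
  have sva := noFourCycle_sq_window hva
  have svb := noFourCycle_sq_window hvb
  have svc := noFourCycle_sq_window hvc
  have svd := noFourCycle_sq_window hvd
  rw [dist_sq_fin3, h0, h1, h2] at sva svb svc svd
  have sa := noFourCycle_sq_window ha
  have sb := noFourCycle_sq_window hb
  have sc := noFourCycle_sq_window hc
  have sd := noFourCycle_sq_window hd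
  rw [norm_sq_fin3] at sa sb sc sd
  have sab := noFourCycle_sq_window hab
  have sbc := noFourCycle_sq_window hbc
  have scd := noFourCycle_sq_window hcd
  have sda := noFourCycle_sq_window hda
  have sac := noFourCycle_sq_lower hac
  have sbd := noFourCycle_sq_lower hbd
  rw [dist_sq_fin3] at sab sbc scd sda sac sbd
  exact noFourCycle_coord hv sa sb sc sd
    ⟨by linarith only [sva.1], by linarith only [sva.2]⟩
    ⟨by linarith only [svb.1], by linarith only [svb.2]⟩
    ⟨by linarith only [svc.1], by linarith only [svc.2]⟩
    ⟨by linarith only [svd.1], by linarith only [svd.2]⟩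
    sab sbc scd sda sac sbd

end Summit.AtomisticToContinuum.Crystallization.Theorems
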